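import Mathlib
import Summits.Ventures.PercRepro2.CoinChainXACellFacts
import Summits.Ventures.PercRepro2.CoinChainXAClosedGateSums
import Summits.Ventures.PercRepro2.CoinChainXAClosedGateGenSums

/-!
# The cell-level Ahlswede–Daykin facts of the three-coin chain (A): the full law `c` on the coin-entered side against the surviving and sure-entered cells
(blind cell PercRepro2, night-2 g33; proofs/NIGHT2-DARC.md §73.6, §73.8)

Each theorem is one application of `cell_fact` (the generic weighted four-functions inequality) with the point-marker
cell weights `(1 − x)(1 − y)`, `x(1 − y)`, `(1 − x)y`, `xy` (and `x`, `1 − x` for the `IM` facts), the laws `c − d`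
(coin-killed), `d` (coin-surviving / sure-entered), `c`, and the piecewise killed law `κ` on the `m`-free meet region;
the meet sum is split into the ideal (where the markers vanish) and the coin-entered cells.  Statements are written
with the twelve marker cells `K₀ K₁ K₂ K₁₂ u₀ U₁ U₂ U₁₂ b b₁ b₂ b₁₂` and the ideal mass `a` as explicit sums, so that a
chain file's `set` abstractions pick them up verbatim.
-/

namespace Summit.Ventures.PercRepro2.Coin

open Classical

section CellFactsA

variable {V : Type*} [DecidableEq V] {R : Type*} [Field R] [LinearOrder R] [IsStrictOrderedRing R]

/-- cell fact `A1U2`: (K1 + U1)·(U2) ≤ (a + K0 + u0)·(U12) — one weighted Ahlswede–Daykin instance. -/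
theorem cg_cell_A1U2 (U : Finset V) (m j j' : V) (ent' : Finset V) (ν c d : Finset V → R)
    (hν0 : ∀ W, 0 ≤ ν W) (hν : ∀ s ⊆ U, ∀ t ⊆ U, ν s * ν t ≤ ν (s ∩ t) * ν (s ∪ t))
    (hc0 : ∀ W, 0 ≤ c W) (hd0 : ∀ W, 0 ≤ d W)
    (hcd : ∀ s t, c s * d t ≤ c (s ∩ t) * d (s ∪ t))
    (x y : Finset V → R) (hx : ∀ W, x W = if j ∈ W then 1 else 0) (hy : ∀ W, y W = if j' ∈ W then 1 else 0)
    (hxI : ∀ W, (¬ ∃ r ∈ ({m} : Finset V) ∪ ent', r ∈ W) → x W = 0) (hyI : ∀ W, (¬ ∃ r ∈ ({m} : Finset V) ∪ ent', r ∈ W) → y W = 0) :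
    0 ≤ ((∑ W ∈ U.powerset.filter (fun W => ¬ ∃ r ∈ ({m} : Finset V) ∪ ent', r ∈ W), ν W * c W) + ((∑ W ∈ U.powerset.filter (fun W => (¬ ∃ r ∈ ({m} : Finset V), r ∈ W) ∧ ∃ r ∈ ent', r ∈ W), ν W * (c W - d W) * ((1 - x W) * (1 - y W))) + (∑ W ∈ U.powerset.filter (fun W => (¬ ∃ r ∈ ({m} : Finset V), r ∈ W) ∧ ∃ r ∈ ent', r ∈ W), ν W * d W * ((1 - x W) * (1 - y W))))) * (∑ W ∈ U.powerset.filter (fun W => (¬ ∃ r ∈ ({m} : Finset V), r ∈ W) ∧ ∃ r ∈ ent', r ∈ W), ν W * d W * (x W * y W)) - ((∑ W ∈ U.powerset.filter (fun W => (¬ ∃ r ∈ ({m} : Finset V), r ∈ W) ∧ ∃ r ∈ ent', r ∈ W), ν W * (c W - d W) * (x W * (1 - y W))) + (∑ W ∈ U.powerset.filter (fun W => (¬ ∃ r ∈ ({m} : Finset V), r ∈ W) ∧ ∃ r ∈ ent', r ∈ W), ν W * d W * (x W * (1 - y W)))) * (∑ W ∈ U.powerset.filter (fun W => (¬ ∃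 r ∈ ({m} : Finset V), r ∈ W) ∧ ∃ r ∈ ent', r ∈ W), ν W * d W * ((1 - x W) * y W)) := by
  have hx0 := mg_x0 j x hx; have hy0 := mg_x0 j' y hy; have hx1 := mg_x1 j x hx; have hy1 := mg_x1 j' y hy
  have hw : ∀ s t : Finset V, (x s * (1 - y s)) * ((1 - x t) * y t) ≤ ((1 - x (s ∩ t)) * (1 - y (s ∩ t))) * (x (s ∪ t) * y (s ∪ t)) := fun s t => by
    simp only [mg_x_inter j x hx, mg_x_inter j' y hy, mg_x_union j x hx, mg_x_union j' y hy]
    rcases mg_marker_cases j x hx s with hxs | hxs <;> rcases mg_marker_cases j x hx t with hxt | hxt <;>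
      rcases mg_marker_cases j' y hy s with hys | hys <;> rcases mg_marker_cases j' y hy t with hyt | hyt <;>
      simp only [hxs, hxt, hys, hyt] <;> norm_num
  have key : (∑ W ∈ U.powerset.filter (fun W => (¬ ∃ r ∈ ({m} : Finset V), r ∈ W) ∧ ∃ r ∈ ent', r ∈ W), ν W * c W * (x W * (1 - y W))) * (∑ W ∈ U.powerset.filter (fun W => (¬ ∃ r ∈ ({m} : Finset V), r ∈ W) ∧ ∃ r ∈ ent', r ∈ W), ν W * d W * ((1 - x W) * y W)) ≤ (∑ W ∈ U.powerset.filter (fun W => ¬ ∃ r ∈ ({m} : Finset V), r ∈ W), ν W * c W * ((1 - x W) * (1 - y W))) * (∑ W ∈ U.powerset.filter (fun W => (¬ ∃ r ∈ ({m} : Finset V), r ∈ W) ∧ ∃ r ∈ ent', r ∈ W), ν W * d W * (x W * y W)) :=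
    cell_fact U ν (c) (d) (c) (d)
      (fun W => x W * (1 - y W)) (fun W => (1 - x W) * y W) (fun W => (1 - x W) * (1 - y W)) (fun W => x W * y W)
      (fun W => (¬ ∃ r ∈ ({m} : Finset V), r ∈ W) ∧ ∃ r ∈ ent', r ∈ W) (fun W => (¬ ∃ r ∈ ({m} : Finset V), r ∈ W) ∧ ∃ r ∈ ent', r ∈ W) (fun W => ¬ ∃ r ∈ ({m} : Finset V), r ∈ W) (fun W => (¬ ∃ r ∈ ({m} : Finset V), r ∈ W) ∧ ∃ r ∈ ent', r ∈ W)
      hν0 hν hc0 hd0 hc0 hd0 (fun W => mul_nonneg (hx0 W) (sub_nonneg.2 (hy1 W))) (fun W => mul_nonneg (sub_nonneg.2 (hx1 W)) (hy0 W)) (fun W => mul_nonneg (sub_nonneg.2 (hx1 W)) (sub_nonneg.2 (hy1 W))) (fun W => mul_nonneg (hx0 W) (hy0 W))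
      (fun s t hA hB => ⟨fun ⟨r, hr, hrW⟩ => hA.1 ⟨r, hr, (Finset.mem_inter.1 hrW).1⟩, ⟨fun ⟨r, hr, hrW⟩ => (Finset.mem_union.1 hrW).elim (fun h => hA.1 ⟨r, hr, h⟩) (fun h => hB.1 ⟨r, hr, h⟩), hA.2.elim (fun r hr => ⟨r, hr.1, Finset.mem_union_left t hr.2⟩)⟩⟩)
      (fun s t _ _ => hcd s t)
      hw
  have eS : (∑ W ∈ U.powerset.filter (fun W => (¬ ∃ r ∈ ({m} : Finset V), r ∈ W) ∧ ∃ r ∈ ent', r ∈ W), ν W * c W * (x W * (1 - y W))) = (∑ W ∈ U.powerset.filter (fun W => (¬ ∃ r ∈ ({m} : Finset V), r ∈ W) ∧ ∃ r ∈ ent', r ∈ W), ν W * (c W - d W) * (x W * (1 - y W))) + (∑ W ∈ U.powerset.filter (fun W => (¬ ∃ r ∈ ({m} : Finset V), r ∈ W) ∧ ∃ r ∈ ent', r ∈ W), ν W * d W * (x W * (1 - y W))) := by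
    rw [← Finset.sum_add_distrib]
    exact Finset.sum_congr rfl (fun W _ => by ring)
  rw [eS] at key
  have eP : (∑ W ∈ U.powerset.filter (fun W => ¬ ∃ r ∈ ({m} : Finset V), r ∈ W), ν W * c W * ((1 - x W) * (1 - y W))) = (∑ W ∈ U.powerset.filter (fun W => ¬ ∃ r ∈ ({m} : Finset V) ∪ ent', r ∈ W), ν W * c W * ((1 - x W) * (1 - y W))) + (∑ W ∈ U.powerset.filter (fun W => (¬ ∃ r ∈ ({m} : Finset V), r ∈ W) ∧ ∃ r ∈ ent', r ∈ W), ν W * c W * ((1 - x W) * (1 - y W))) :=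
    sum_entfree_split U {m} ent' (fun W => ν W * c W * ((1 - x W) * (1 - y W)))
  have eI : (∑ W ∈ U.powerset.filter (fun W => ¬ ∃ r ∈ ({m} : Finset V) ∪ ent', r ∈ W), ν W * c W * ((1 - x W) * (1 - y W))) = (∑ W ∈ U.powerset.filter (fun W => ¬ ∃ r ∈ ({m} : Finset V) ∪ ent', r ∈ W), ν W * c W) :=
    Finset.sum_congr rfl (fun W hW => by
      rw [hxI W (Finset.mem_filter.1 hW).2, hyI W (Finset.mem_filter.1 hW).2]; ring)
  have eD : (∑ W ∈ U.powerset.filter (fun W => (¬ ∃ r ∈ ({m} : Finset V), r ∈ W) ∧ ∃ r ∈ ent', r ∈ W), ν W * c W * ((1 - x W) * (1 - y W))) = (∑ W ∈ U.powerset.filter (fun W => (¬ ∃ r ∈ ({m} : Finset V), r ∈ W) ∧ ∃ r ∈ ent', r ∈ W), ν W * (c W - d W) * ((1 - x W) * (1 - y W))) + (∑ W ∈ U.powerset.filter (fun W => (¬ ∃ r ∈ ({m} : Finset V), r ∈ W) ∧ ∃ r ∈ ent', r ∈ W), ν W * d W * ((1 - x W) * (1 - y W))) := by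
    rw [← Finset.sum_add_distrib]
    exact Finset.sum_congr rfl (fun W _ => by ring)
  rw [eP, eI, eD] at key
  linear_combination key

/-- cell fact `A2U1`: (K2 + U2)·(U1) ≤ (a + K0 + u0)·(U12) — one weighted Ahlswede–Daykin instance. -/
theorem cg_cell_A2U1 (U : Finset V) (m j j' : V) (ent' : Finset V) (ν c d : Finset V → R)
    (hν0 : ∀ W, 0 ≤ ν W) (hν : ∀ s ⊆ U, ∀ t ⊆ U, ν s * ν t ≤ ν (s ∩ t) * ν (s ∪ t))
    (hc0 : ∀ W, 0 ≤ c W) (hd0 : ∀ W, 0 ≤ d W)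
    (hcd : ∀ s t, c s * d t ≤ c (s ∩ t) * d (s ∪ t))
    (x y : Finset V → R) (hx : ∀ W, x W = if j ∈ W then 1 else 0) (hy : ∀ W, y W = if j' ∈ W then 1 else 0)
    (hxI : ∀ W, (¬ ∃ r ∈ ({m} : Finset V) ∪ ent', r ∈ W) → x W = 0) (hyI : ∀ W, (¬ ∃ r ∈ ({m} : Finset V) ∪ ent', r ∈ W) → y W = 0) :
    0 ≤ ((∑ W ∈ U.powerset.filter (fun W => ¬ ∃ r ∈ ({m} : Finset V) ∪ ent', r ∈ W), ν W * c W) + ((∑ W ∈ U.powerset.filter (fun W => (¬ ∃ r ∈ ({m} : Finset V), r ∈ W) ∧ ∃ r ∈ ent', r ∈ W), ν W * (c W - d W) * ((1 - x W) * (1 - y W))) + (∑ W ∈ U.powerset.filter (fun W => (¬ ∃ r ∈ ({m} : Finset V), r ∈ W) ∧ ∃ r ∈ ent', r ∈ W), ν W * d W * ((1 - x W) * (1 - y W))))) * (∑ W ∈ U.powerset.filter (fun W => (¬ ∃ r ∈ ({m} : Finset V), r ∈ W) ∧ ∃ r ∈ ent', r ∈ W), ν W * d W * (x W * y W)) - ((∑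 W ∈ U.powerset.filter (fun W => (¬ ∃ r ∈ ({m} : Finset V), r ∈ W) ∧ ∃ r ∈ ent', r ∈ W), ν W * (c W - d W) * ((1 - x W) * y W)) + (∑ W ∈ U.powerset.filter (fun W => (¬ ∃ r ∈ ({m} : Finset V), r ∈ W) ∧ ∃ r ∈ ent', r ∈ W), ν W * d W * ((1 - x W) * y W))) * (∑ W ∈ U.powerset.filter (fun W => (¬ ∃ r ∈ ({m} : Finset V), r ∈ W) ∧ ∃ r ∈ ent', r ∈ W), ν W * d W * (x W * (1 - y W))) := by
  have hx0 := mg_x0 j x hx; have hy0 := mg_x0 j' y hy; have hx1 := mg_x1 j x hx; have hy1 := mg_x1 j' y hy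
  have hw : ∀ s t : Finset V, ((1 - x s) * y s) * (x t * (1 - y t)) ≤ ((1 - x (s ∩ t)) * (1 - y (s ∩ t))) * (x (s ∪ t) * y (s ∪ t)) := fun s t => by
    simp only [mg_x_inter j x hx, mg_x_inter j' y hy, mg_x_union j x hx, mg_x_union j' y hy]
    rcases mg_marker_cases j x hx s with hxs | hxs <;> rcases mg_marker_cases j x hx t with hxt | hxt <;>
      rcases mg_marker_cases j' y hy s with hys | hys <;> rcases mg_marker_cases j' y hy t with hyt | hyt <;>
      simp only [hxs, hxt, hys, hyt] <;> norm_num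
  have key : (∑ W ∈ U.powerset.filter (fun W => (¬ ∃ r ∈ ({m} : Finset V), r ∈ W) ∧ ∃ r ∈ ent', r ∈ W), ν W * c W * ((1 - x W) * y W)) * (∑ W ∈ U.powerset.filter (fun W => (¬ ∃ r ∈ ({m} : Finset V), r ∈ W) ∧ ∃ r ∈ ent', r ∈ W), ν W * d W * (x W * (1 - y W))) ≤ (∑ W ∈ U.powerset.filter (fun W => ¬ ∃ r ∈ ({m} : Finset V), r ∈ W), ν W * c W * ((1 - x W) * (1 - y W))) * (∑ W ∈ U.powerset.filter (fun W => (¬ ∃ r ∈ ({m} : Finset V), r ∈ W) ∧ ∃ r ∈ ent', r ∈ W), ν W * d W * (x W * y W)) :=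
    cell_fact U ν (c) (d) (c) (d)
      (fun W => (1 - x W) * y W) (fun W => x W * (1 - y W)) (fun W => (1 - x W) * (1 - y W)) (fun W => x W * y W)
      (fun W => (¬ ∃ r ∈ ({m} : Finset V), r ∈ W) ∧ ∃ r ∈ ent', r ∈ W) (fun W => (¬ ∃ r ∈ ({m} : Finset V), r ∈ W) ∧ ∃ r ∈ ent', r ∈ W) (fun W => ¬ ∃ r ∈ ({m} : Finset V), r ∈ W) (fun W => (¬ ∃ r ∈ ({m} : Finset V), r ∈ W) ∧ ∃ r ∈ ent', r ∈ W)
      hν0 hν hc0 hd0 hc0 hd0 (fun W => mul_nonneg (sub_nonneg.2 (hx1 W)) (hy0 W)) (fun W => mul_nonneg (hx0 W) (sub_nonneg.2 (hy1 W))) (fun W => mul_nonneg (sub_nonneg.2 (hx1 W)) (sub_nonneg.2 (hy1 W))) (fun W => mul_nonneg (hx0 W) (hy0 W))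
      (fun s t hA hB => ⟨fun ⟨r, hr, hrW⟩ => hA.1 ⟨r, hr, (Finset.mem_inter.1 hrW).1⟩, ⟨fun ⟨r, hr, hrW⟩ => (Finset.mem_union.1 hrW).elim (fun h => hA.1 ⟨r, hr, h⟩) (fun h => hB.1 ⟨r, hr, h⟩), hA.2.elim (fun r hr => ⟨r, hr.1, Finset.mem_union_left t hr.2⟩)⟩⟩)
      (fun s t _ _ => hcd s t)
      hw
  have eS : (∑ W ∈ U.powerset.filter (fun W => (¬ ∃ r ∈ ({m} : Finset V), r ∈ W) ∧ ∃ r ∈ ent', r ∈ W), ν W * c W * ((1 - x W) * y W)) = (∑ W ∈ U.powerset.filter (fun W => (¬ ∃ r ∈ ({m} : Finset V), r ∈ W) ∧ ∃ r ∈ ent', r ∈ W), ν W * (c W - d W) * ((1 - x W) * y W)) + (∑ W ∈ U.powerset.filter (fun W => (¬ ∃ r ∈ ({m} : Finset V), r ∈ W) ∧ ∃ r ∈ ent', r ∈ W), ν W * d W * ((1 - x W) * y W)) := by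
    rw [← Finset.sum_add_distrib]
    exact Finset.sum_congr rfl (fun W _ => by ring)
  rw [eS] at key
  have eP : (∑ W ∈ U.powerset.filter (fun W => ¬ ∃ r ∈ ({m} : Finset V), r ∈ W), ν W * c W * ((1 - x W) * (1 - y W))) = (∑ W ∈ U.powerset.filter (fun W => ¬ ∃ r ∈ ({m} : Finset V) ∪ ent', r ∈ W), ν W * c W * ((1 - x W) * (1 - y W))) + (∑ W ∈ U.powerset.filter (fun W => (¬ ∃ r ∈ ({m} : Finset V), r ∈ W) ∧ ∃ r ∈ ent', r ∈ W), ν W * c W * ((1 - x W) * (1 - y W))) :=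
    sum_entfree_split U {m} ent' (fun W => ν W * c W * ((1 - x W) * (1 - y W)))
  have eI : (∑ W ∈ U.powerset.filter (fun W => ¬ ∃ r ∈ ({m} : Finset V) ∪ ent', r ∈ W), ν W * c W * ((1 - x W) * (1 - y W))) = (∑ W ∈ U.powerset.filter (fun W => ¬ ∃ r ∈ ({m} : Finset V) ∪ ent', r ∈ W), ν W * c W) :=
    Finset.sum_congr rfl (fun W hW => by
      rw [hxI W (Finset.mem_filter.1 hW).2, hyI W (Finset.mem_filter.1 hW).2]; ring)
  have eD : (∑ W ∈ U.powerset.filter (fun W => (¬ ∃ r ∈ ({m} : Finset V), r ∈ W) ∧ ∃ r ∈ ent', r ∈ W), ν W * c W * ((1 - x W) * (1 - y W))) = (∑ W ∈ U.powerset.filter (fun W => (¬ ∃ r ∈ ({m} : Finset V), r ∈ W) ∧ ∃ r ∈ ent', r ∈ W), ν W * (c W - d W) * ((1 - x W) * (1 - y W))) + (∑ W ∈ U.powerset.filter (fun W => (¬ ∃ r ∈ ({m} : Finset V), r ∈ W) ∧ ∃ r ∈ ent', r ∈ W), ν W * d W * ((1 - x W) * (1 - y W))) := by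
    rw [← Finset.sum_add_distrib]
    exact Finset.sum_congr rfl (fun W _ => by ring)
  rw [eP, eI, eD] at key
  linear_combination key

/-- cell fact `A1b`: (K1 + U1)·(b) ≤ (a + K0 + u0)·(b1) — one weighted Ahlswede–Daykin instance. -/
theorem cg_cell_A1b (U : Finset V) (m j j' : V) (ent' : Finset V) (ν c d : Finset V → R)
    (hν0 : ∀ W, 0 ≤ ν W) (hν : ∀ s ⊆ U, ∀ t ⊆ U, ν s * ν t ≤ ν (s ∩ t) * ν (s ∪ t))
    (hc0 : ∀ W, 0 ≤ c W) (hd0 : ∀ W, 0 ≤ d W)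
    (hcd : ∀ s t, c s * d t ≤ c (s ∩ t) * d (s ∪ t))
    (x y : Finset V → R) (hx : ∀ W, x W = if j ∈ W then 1 else 0) (hy : ∀ W, y W = if j' ∈ W then 1 else 0)
    (hxI : ∀ W, (¬ ∃ r ∈ ({m} : Finset V) ∪ ent', r ∈ W) → x W = 0) (hyI : ∀ W, (¬ ∃ r ∈ ({m} : Finset V) ∪ ent', r ∈ W) → y W = 0) :
    0 ≤ ((∑ W ∈ U.powerset.filter (fun W => ¬ ∃ r ∈ ({m} : Finset V) ∪ ent', r ∈ W), ν W * c W) + ((∑ W ∈ U.powerset.filter (fun W => (¬ ∃ r ∈ ({m} : Finset V), r ∈ W) ∧ ∃ r ∈ ent', r ∈ W), ν W * (c W - d W) * ((1 - x W) * (1 - y W))) + (∑ W ∈ U.powerset.filter (fun W => (¬ ∃ r ∈ ({m} : Finset V), r ∈ W) ∧ ∃ r ∈ ent', r ∈ W), ν W * d W * ((1 - x W) * (1 - y W))))) * (∑ W ∈ U.powerset.filter (fun W => ∃ r ∈ ({m} : Finset V), r ∈ W), ν W * d W * (x W * (1 - y W))) - ((∑ W ∈ U.powerset.filter (fun W =>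 (¬ ∃ r ∈ ({m} : Finset V), r ∈ W) ∧ ∃ r ∈ ent', r ∈ W), ν W * (c W - d W) * (x W * (1 - y W))) + (∑ W ∈ U.powerset.filter (fun W => (¬ ∃ r ∈ ({m} : Finset V), r ∈ W) ∧ ∃ r ∈ ent', r ∈ W), ν W * d W * (x W * (1 - y W)))) * (∑ W ∈ U.powerset.filter (fun W => ∃ r ∈ ({m} : Finset V), r ∈ W), ν W * d W * ((1 - x W) * (1 - y W))) := by
  have hx0 := mg_x0 j x hx; have hy0 := mg_x0 j' y hy; have hx1 := mg_x1 j x hx; have hy1 := mg_x1 j' y hy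
  have hw : ∀ s t : Finset V, (x s * (1 - y s)) * ((1 - x t) * (1 - y t)) ≤ ((1 - x (s ∩ t)) * (1 - y (s ∩ t))) * (x (s ∪ t) * (1 - y (s ∪ t))) := fun s t => by
    simp only [mg_x_inter j x hx, mg_x_inter j' y hy, mg_x_union j x hx, mg_x_union j' y hy]
    rcases mg_marker_cases j x hx s with hxs | hxs <;> rcases mg_marker_cases j x hx t with hxt | hxt <;>
      rcases mg_marker_cases j' y hy s with hys | hys <;> rcases mg_marker_cases j' y hy t with hyt | hyt <;>
      simp only [hxs, hxt, hys, hyt] <;> norm_num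
  have key : (∑ W ∈ U.powerset.filter (fun W => (¬ ∃ r ∈ ({m} : Finset V), r ∈ W) ∧ ∃ r ∈ ent', r ∈ W), ν W * c W * (x W * (1 - y W))) * (∑ W ∈ U.powerset.filter (fun W => ∃ r ∈ ({m} : Finset V), r ∈ W), ν W * d W * ((1 - x W) * (1 - y W))) ≤ (∑ W ∈ U.powerset.filter (fun W => ¬ ∃ r ∈ ({m} : Finset V), r ∈ W), ν W * c W * ((1 - x W) * (1 - y W))) * (∑ W ∈ U.powerset.filter (fun W => ∃ r ∈ ({m} : Finset V), r ∈ W), ν W * d W * (x W * (1 - y W))) :=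
    cell_fact U ν (c) (d) (c) (d)
      (fun W => x W * (1 - y W)) (fun W => (1 - x W) * (1 - y W)) (fun W => (1 - x W) * (1 - y W)) (fun W => x W * (1 - y W))
      (fun W => (¬ ∃ r ∈ ({m} : Finset V), r ∈ W) ∧ ∃ r ∈ ent', r ∈ W) (fun W => ∃ r ∈ ({m} : Finset V), r ∈ W) (fun W => ¬ ∃ r ∈ ({m} : Finset V), r ∈ W) (fun W => ∃ r ∈ ({m} : Finset V), r ∈ W)
      hν0 hν hc0 hd0 hc0 hd0 (fun W => mul_nonneg (hx0 W) (sub_nonneg.2 (hy1 W))) (fun W => mul_nonneg (sub_nonneg.2 (hx1 W)) (sub_nonneg.2 (hy1 W))) (fun W => mul_nonneg (sub_nonneg.2 (hx1 W)) (sub_nonneg.2 (hy1 W))) (fun W => mul_nonneg (hx0 W) (sub_nonneg.2 (hy1 W)))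
      (fun s t hA hB => ⟨fun ⟨r, hr, hrW⟩ => hA.1 ⟨r, hr, (Finset.mem_inter.1 hrW).1⟩, hB.elim (fun r hr => ⟨r, hr.1, Finset.mem_union_right s hr.2⟩)⟩)
      (fun s t _ _ => hcd s t)
      hw
  have eS : (∑ W ∈ U.powerset.filter (fun W => (¬ ∃ r ∈ ({m} : Finset V), r ∈ W) ∧ ∃ r ∈ ent', r ∈ W), ν W * c W * (x W * (1 - y W))) = (∑ W ∈ U.powerset.filter (fun W => (¬ ∃ r ∈ ({m} : Finset V), r ∈ W) ∧ ∃ r ∈ ent', r ∈ W), ν W * (c W - d W) * (x W * (1 - y W))) + (∑ W ∈ U.powerset.filter (fun W => (¬ ∃ r ∈ ({m} : Finset V), r ∈ W) ∧ ∃ r ∈ ent', r ∈ W), ν W * d W * (x W * (1 - y W))) := by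
    rw [← Finset.sum_add_distrib]
    exact Finset.sum_congr rfl (fun W _ => by ring)
  rw [eS] at key
  have eP : (∑ W ∈ U.powerset.filter (fun W => ¬ ∃ r ∈ ({m} : Finset V), r ∈ W), ν W * c W * ((1 - x W) * (1 - y W))) = (∑ W ∈ U.powerset.filter (fun W => ¬ ∃ r ∈ ({m} : Finset V) ∪ ent', r ∈ W), ν W * c W * ((1 - x W) * (1 - y W))) + (∑ W ∈ U.powerset.filter (fun W => (¬ ∃ r ∈ ({m} : Finset V), r ∈ W) ∧ ∃ r ∈ ent', r ∈ W), ν W * c W * ((1 - x W) * (1 - y W))) :=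
    sum_entfree_split U {m} ent' (fun W => ν W * c W * ((1 - x W) * (1 - y W)))
  have eI : (∑ W ∈ U.powerset.filter (fun W => ¬ ∃ r ∈ ({m} : Finset V) ∪ ent', r ∈ W), ν W * c W * ((1 - x W) * (1 - y W))) = (∑ W ∈ U.powerset.filter (fun W => ¬ ∃ r ∈ ({m} : Finset V) ∪ ent', r ∈ W), ν W * c W) :=
    Finset.sum_congr rfl (fun W hW => by
      rw [hxI W (Finset.mem_filter.1 hW).2, hyI W (Finset.mem_filter.1 hW).2]; ring)
  have eD : (∑ W ∈ U.powerset.filter (fun W => (¬ ∃ r ∈ ({m} : Finset V), r ∈ W) ∧ ∃ r ∈ ent', r ∈ W), ν W * c W * ((1 - x W) * (1 - y W))) = (∑ W ∈ U.powerset.filter (fun W => (¬ ∃ r ∈ ({m} : Finset V), r ∈ W) ∧ ∃ r ∈ ent', r ∈ W), ν W * (c W - d W) * ((1 - x W) * (1 - y W))) + (∑ W ∈ U.powerset.filter (fun W => (¬ ∃ r ∈ ({m} : Finset V), r ∈ W) ∧ ∃ r ∈ ent', r ∈ W), ν W * d W * ((1 - x W) * (1 - y W))) := by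
    rw [← Finset.sum_add_distrib]
    exact Finset.sum_congr rfl (fun W _ => by ring)
  rw [eP, eI, eD] at key
  linear_combination key

/-- cell fact `A2b`: (K2 + U2)·(b) ≤ (a + K0 + u0)·(b2) — one weighted Ahlswede–Daykin instance. -/
theorem cg_cell_A2b (U : Finset V) (m j j' : V) (ent' : Finset V) (ν c d : Finset V → R)
    (hν0 : ∀ W, 0 ≤ ν W) (hν : ∀ s ⊆ U, ∀ t ⊆ U, ν s * ν t ≤ ν (s ∩ t) * ν (s ∪ t))
    (hc0 : ∀ W, 0 ≤ c W) (hd0 : ∀ W, 0 ≤ d W)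
    (hcd : ∀ s t, c s * d t ≤ c (s ∩ t) * d (s ∪ t))
    (x y : Finset V → R) (hx : ∀ W, x W = if j ∈ W then 1 else 0) (hy : ∀ W, y W = if j' ∈ W then 1 else 0)
    (hxI : ∀ W, (¬ ∃ r ∈ ({m} : Finset V) ∪ ent', r ∈ W) → x W = 0) (hyI : ∀ W, (¬ ∃ r ∈ ({m} : Finset V) ∪ ent', r ∈ W) → y W = 0) :
    0 ≤ ((∑ W ∈ U.powerset.filter (fun W => ¬ ∃ r ∈ ({m} : Finset V) ∪ ent', r ∈ W), ν W * c W) + ((∑ W ∈ U.powerset.filter (fun W => (¬ ∃ r ∈ ({m} : Finset V), r ∈ W) ∧ ∃ r ∈ ent', r ∈ W), ν W * (c W - d W) * ((1 - x W) * (1 - y W))) + (∑ W ∈ U.powerset.filter (fun W => (¬ ∃ r ∈ ({m} : Finset V), r ∈ W) ∧ ∃ r ∈ ent', r ∈ W), ν W * d W * ((1 - x W) * (1 - y W))))) * (∑ W ∈ U.powerset.filter (fun W => ∃ r ∈ ({m} : Finset V), r ∈ W), ν W * d W * ((1 - x W) * y W)) - ((∑ W ∈ U.powerset.filter (fun W =>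 (¬ ∃ r ∈ ({m} : Finset V), r ∈ W) ∧ ∃ r ∈ ent', r ∈ W), ν W * (c W - d W) * ((1 - x W) * y W)) + (∑ W ∈ U.powerset.filter (fun W => (¬ ∃ r ∈ ({m} : Finset V), r ∈ W) ∧ ∃ r ∈ ent', r ∈ W), ν W * d W * ((1 - x W) * y W))) * (∑ W ∈ U.powerset.filter (fun W => ∃ r ∈ ({m} : Finset V), r ∈ W), ν W * d W * ((1 - x W) * (1 - y W))) := by
  have hx0 := mg_x0 j x hx; have hy0 := mg_x0 j' y hy; have hx1 := mg_x1 j x hx; have hy1 := mg_x1 j' y hy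
  have hw : ∀ s t : Finset V, ((1 - x s) * y s) * ((1 - x t) * (1 - y t)) ≤ ((1 - x (s ∩ t)) * (1 - y (s ∩ t))) * ((1 - x (s ∪ t)) * y (s ∪ t)) := fun s t => by
    simp only [mg_x_inter j x hx, mg_x_inter j' y hy, mg_x_union j x hx, mg_x_union j' y hy]
    rcases mg_marker_cases j x hx s with hxs | hxs <;> rcases mg_marker_cases j x hx t with hxt | hxt <;>
      rcases mg_marker_cases j' y hy s with hys | hys <;> rcases mg_marker_cases j' y hy t with hyt | hyt <;>
      simp only [hxs, hxt, hys, hyt] <;> norm_num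
  have key : (∑ W ∈ U.powerset.filter (fun W => (¬ ∃ r ∈ ({m} : Finset V), r ∈ W) ∧ ∃ r ∈ ent', r ∈ W), ν W * c W * ((1 - x W) * y W)) * (∑ W ∈ U.powerset.filter (fun W => ∃ r ∈ ({m} : Finset V), r ∈ W), ν W * d W * ((1 - x W) * (1 - y W))) ≤ (∑ W ∈ U.powerset.filter (fun W => ¬ ∃ r ∈ ({m} : Finset V), r ∈ W), ν W * c W * ((1 - x W) * (1 - y W))) * (∑ W ∈ U.powerset.filter (fun W => ∃ r ∈ ({m} : Finset V), r ∈ W), ν W * d W * ((1 - x W) * y W)) :=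
    cell_fact U ν (c) (d) (c) (d)
      (fun W => (1 - x W) * y W) (fun W => (1 - x W) * (1 - y W)) (fun W => (1 - x W) * (1 - y W)) (fun W => (1 - x W) * y W)
      (fun W => (¬ ∃ r ∈ ({m} : Finset V), r ∈ W) ∧ ∃ r ∈ ent', r ∈ W) (fun W => ∃ r ∈ ({m} : Finset V), r ∈ W) (fun W => ¬ ∃ r ∈ ({m} : Finset V), r ∈ W) (fun W => ∃ r ∈ ({m} : Finset V), r ∈ W)
      hν0 hν hc0 hd0 hc0 hd0 (fun W => mul_nonneg (sub_nonneg.2 (hx1 W)) (hy0 W)) (fun W => mul_nonneg (sub_nonneg.2 (hx1 W)) (sub_nonneg.2 (hy1 W))) (fun W => mul_nonneg (sub_nonneg.2 (hx1 W)) (sub_nonneg.2 (hy1 W))) (fun W => mul_nonneg (sub_nonneg.2 (hx1 W)) (hy0 W))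
      (fun s t hA hB => ⟨fun ⟨r, hr, hrW⟩ => hA.1 ⟨r, hr, (Finset.mem_inter.1 hrW).1⟩, hB.elim (fun r hr => ⟨r, hr.1, Finset.mem_union_right s hr.2⟩)⟩)
      (fun s t _ _ => hcd s t)
      hw
  have eS : (∑ W ∈ U.powerset.filter (fun W => (¬ ∃ r ∈ ({m} : Finset V), r ∈ W) ∧ ∃ r ∈ ent', r ∈ W), ν W * c W * ((1 - x W) * y W)) = (∑ W ∈ U.powerset.filter (fun W => (¬ ∃ r ∈ ({m} : Finset V), r ∈ W) ∧ ∃ r ∈ ent', r ∈ W), ν W * (c W - d W) * ((1 - x W) * y W)) + (∑ W ∈ U.powerset.filter (fun W => (¬ ∃ r ∈ ({m} : Finset V), r ∈ W) ∧ ∃ r ∈ ent', r ∈ W), ν W * d W * ((1 - x W) * y W)) := by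
    rw [← Finset.sum_add_distrib]
    exact Finset.sum_congr rfl (fun W _ => by ring)
  rw [eS] at key
  have eP : (∑ W ∈ U.powerset.filter (fun W => ¬ ∃ r ∈ ({m} : Finset V), r ∈ W), ν W * c W * ((1 - x W) * (1 - y W))) = (∑ W ∈ U.powerset.filter (fun W => ¬ ∃ r ∈ ({m} : Finset V) ∪ ent', r ∈ W), ν W * c W * ((1 - x W) * (1 - y W))) + (∑ W ∈ U.powerset.filter (fun W => (¬ ∃ r ∈ ({m} : Finset V), r ∈ W) ∧ ∃ r ∈ ent', r ∈ W), ν W * c W * ((1 - x W) * (1 - y W))) :=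
    sum_entfree_split U {m} ent' (fun W => ν W * c W * ((1 - x W) * (1 - y W)))
  have eI : (∑ W ∈ U.powerset.filter (fun W => ¬ ∃ r ∈ ({m} : Finset V) ∪ ent', r ∈ W), ν W * c W * ((1 - x W) * (1 - y W))) = (∑ W ∈ U.powerset.filter (fun W => ¬ ∃ r ∈ ({m} : Finset V) ∪ ent', r ∈ W), ν W * c W) :=
    Finset.sum_congr rfl (fun W hW => by
      rw [hxI W (Finset.mem_filter.1 hW).2, hyI W (Finset.mem_filter.1 hW).2]; ring)
  have eD : (∑ W ∈ U.powerset.filter (fun W => (¬ ∃ r ∈ ({m} : Finset V), r ∈ W) ∧ ∃ r ∈ ent', r ∈ W), ν W * c W * ((1 - x W) * (1 - y W))) = (∑ W ∈ U.powerset.filter (fun W => (¬ ∃ r ∈ ({m} : Finset V), r ∈ W) ∧ ∃ r ∈ ent', r ∈ W), ν W * (c W - d W) * ((1 - x W) * (1 - y W))) + (∑ W ∈ U.powerset.filter (fun W => (¬ ∃ r ∈ ({m} : Finset V), r ∈ W) ∧ ∃ r ∈ ent', r ∈ W), ν W * d W * ((1 - x W) * (1 - y W))) := by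
    rw [← Finset.sum_add_distrib]
    exact Finset.sum_congr rfl (fun W _ => by ring)
  rw [eP, eI, eD] at key
  linear_combination key

/-- cell fact `A1b2`: (K1 + U1)·(b2) ≤ (a + K0 + u0)·(b12) — one weighted Ahlswede–Daykin instance. -/
theorem cg_cell_A1b2 (U : Finset V) (m j j' : V) (ent' : Finset V) (ν c d : Finset V → R)
    (hν0 : ∀ W, 0 ≤ ν W) (hν : ∀ s ⊆ U, ∀ t ⊆ U, ν s * ν t ≤ ν (s ∩ t) * ν (s ∪ t))
    (hc0 : ∀ W, 0 ≤ c W) (hd0 : ∀ W, 0 ≤ d W)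
    (hcd : ∀ s t, c s * d t ≤ c (s ∩ t) * d (s ∪ t))
    (x y : Finset V → R) (hx : ∀ W, x W = if j ∈ W then 1 else 0) (hy : ∀ W, y W = if j' ∈ W then 1 else 0)
    (hxI : ∀ W, (¬ ∃ r ∈ ({m} : Finset V) ∪ ent', r ∈ W) → x W = 0) (hyI : ∀ W, (¬ ∃ r ∈ ({m} : Finset V) ∪ ent', r ∈ W) → y W = 0) :
    0 ≤ ((∑ W ∈ U.powerset.filter (fun W => ¬ ∃ r ∈ ({m} : Finset V) ∪ ent', r ∈ W), ν W * c W) + ((∑ W ∈ U.powerset.filter (fun W => (¬ ∃ r ∈ ({m} : Finset V), r ∈ W) ∧ ∃ r ∈ ent', r ∈ W), ν W * (c W - d W) * ((1 - x W) * (1 - y W))) + (∑ W ∈ U.powerset.filter (fun W => (¬ ∃ r ∈ ({m} : Finset V), r ∈ W) ∧ ∃ r ∈ ent', r ∈ W), ν W * d W * ((1 - x W) * (1 - y W))))) * (∑ W ∈ U.powerset.filter (fun W => ∃ r ∈ ({m} : Finset V), r ∈ W), ν W * d W * (x W * y W)) - ((∑ W ∈ U.powerset.filter (fun W => (¬ ∃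 r ∈ ({m} : Finset V), r ∈ W) ∧ ∃ r ∈ ent', r ∈ W), ν W * (c W - d W) * (x W * (1 - y W))) + (∑ W ∈ U.powerset.filter (fun W => (¬ ∃ r ∈ ({m} : Finset V), r ∈ W) ∧ ∃ r ∈ ent', r ∈ W), ν W * d W * (x W * (1 - y W)))) * (∑ W ∈ U.powerset.filter (fun W => ∃ r ∈ ({m} : Finset V), r ∈ W), ν W * d W * ((1 - x W) * y W)) := by
  have hx0 := mg_x0 j x hx; have hy0 := mg_x0 j' y hy; have hx1 := mg_x1 j x hx; have hy1 := mg_x1 j' y hy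
  have hw : ∀ s t : Finset V, (x s * (1 - y s)) * ((1 - x t) * y t) ≤ ((1 - x (s ∩ t)) * (1 - y (s ∩ t))) * (x (s ∪ t) * y (s ∪ t)) := fun s t => by
    simp only [mg_x_inter j x hx, mg_x_inter j' y hy, mg_x_union j x hx, mg_x_union j' y hy]
    rcases mg_marker_cases j x hx s with hxs | hxs <;> rcases mg_marker_cases j x hx t with hxt | hxt <;>
      rcases mg_marker_cases j' y hy s with hys | hys <;> rcases mg_marker_cases j' y hy t with hyt | hyt <;>
      simp only [hxs, hxt, hys, hyt] <;> norm_num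
  have key : (∑ W ∈ U.powerset.filter (fun W => (¬ ∃ r ∈ ({m} : Finset V), r ∈ W) ∧ ∃ r ∈ ent', r ∈ W), ν W * c W * (x W * (1 - y W))) * (∑ W ∈ U.powerset.filter (fun W => ∃ r ∈ ({m} : Finset V), r ∈ W), ν W * d W * ((1 - x W) * y W)) ≤ (∑ W ∈ U.powerset.filter (fun W => ¬ ∃ r ∈ ({m} : Finset V), r ∈ W), ν W * c W * ((1 - x W) * (1 - y W))) * (∑ W ∈ U.powerset.filter (fun W => ∃ r ∈ ({m} : Finset V), r ∈ W), ν W * d W * (x W * y W)) :=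
    cell_fact U ν (c) (d) (c) (d)
      (fun W => x W * (1 - y W)) (fun W => (1 - x W) * y W) (fun W => (1 - x W) * (1 - y W)) (fun W => x W * y W)
      (fun W => (¬ ∃ r ∈ ({m} : Finset V), r ∈ W) ∧ ∃ r ∈ ent', r ∈ W) (fun W => ∃ r ∈ ({m} : Finset V), r ∈ W) (fun W => ¬ ∃ r ∈ ({m} : Finset V), r ∈ W) (fun W => ∃ r ∈ ({m} : Finset V), r ∈ W)
      hν0 hν hc0 hd0 hc0 hd0 (fun W => mul_nonneg (hx0 W) (sub_nonneg.2 (hy1 W))) (fun W => mul_nonneg (sub_nonneg.2 (hx1 W)) (hy0 W)) (fun W => mul_nonneg (sub_nonneg.2 (hx1 W)) (sub_nonneg.2 (hy1 W))) (fun W => mul_nonneg (hx0 W) (hy0 W))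
      (fun s t hA hB => ⟨fun ⟨r, hr, hrW⟩ => hA.1 ⟨r, hr, (Finset.mem_inter.1 hrW).1⟩, hB.elim (fun r hr => ⟨r, hr.1, Finset.mem_union_right s hr.2⟩)⟩)
      (fun s t _ _ => hcd s t)
      hw
  have eS : (∑ W ∈ U.powerset.filter (fun W => (¬ ∃ r ∈ ({m} : Finset V), r ∈ W) ∧ ∃ r ∈ ent', r ∈ W), ν W * c W * (x W * (1 - y W))) = (∑ W ∈ U.powerset.filter (fun W => (¬ ∃ r ∈ ({m} : Finset V), r ∈ W) ∧ ∃ r ∈ ent', r ∈ W), ν W * (c W - d W) * (x W * (1 - y W))) + (∑ W ∈ U.powerset.filter (fun W => (¬ ∃ r ∈ ({m} : Finset V), r ∈ W) ∧ ∃ r ∈ ent', r ∈ W), ν W * d W * (x W * (1 - y W))) := by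
    rw [← Finset.sum_add_distrib]
    exact Finset.sum_congr rfl (fun W _ => by ring)
  rw [eS] at key
  have eP : (∑ W ∈ U.powerset.filter (fun W => ¬ ∃ r ∈ ({m} : Finset V), r ∈ W), ν W * c W * ((1 - x W) * (1 - y W))) = (∑ W ∈ U.powerset.filter (fun W => ¬ ∃ r ∈ ({m} : Finset V) ∪ ent', r ∈ W), ν W * c W * ((1 - x W) * (1 - y W))) + (∑ W ∈ U.powerset.filter (fun W => (¬ ∃ r ∈ ({m} : Finset V), r ∈ W) ∧ ∃ r ∈ ent', r ∈ W), ν W * c W * ((1 - x W) * (1 - y W))) :=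
    sum_entfree_split U {m} ent' (fun W => ν W * c W * ((1 - x W) * (1 - y W)))
  have eI : (∑ W ∈ U.powerset.filter (fun W => ¬ ∃ r ∈ ({m} : Finset V) ∪ ent', r ∈ W), ν W * c W * ((1 - x W) * (1 - y W))) = (∑ W ∈ U.powerset.filter (fun W => ¬ ∃ r ∈ ({m} : Finset V) ∪ ent', r ∈ W), ν W * c W) :=
    Finset.sum_congr rfl (fun W hW => by
      rw [hxI W (Finset.mem_filter.1 hW).2, hyI W (Finset.mem_filter.1 hW).2]; ring)
  have eD : (∑ W ∈ U.powerset.filter (fun W => (¬ ∃ r ∈ ({m} : Finset V), r ∈ W) ∧ ∃ r ∈ ent', r ∈ W), ν W * c W * ((1 - x W) * (1 - y W))) = (∑ W ∈ U.powerset.filter (fun W => (¬ ∃ r ∈ ({m} : Finset V), r ∈ W) ∧ ∃ r ∈ ent', r ∈ W), ν W * (c W - d W) * ((1 - x W) * (1 - y W))) + (∑ W ∈ U.powerset.filter (fun W => (¬ ∃ r ∈ ({m} : Finset V), r ∈ W) ∧ ∃ r ∈ ent', r ∈ W), ν W * d W * ((1 - x W) * (1 - y W))) := by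
    rw [← Finset.sum_add_distrib]
    exact Finset.sum_congr rfl (fun W _ => by ring)
  rw [eP, eI, eD] at key
  linear_combination key

/-- cell fact `A2b1`: (K2 + U2)·(b1) ≤ (a + K0 + u0)·(b12) — one weighted Ahlswede–Daykin instance. -/
theorem cg_cell_A2b1 (U : Finset V) (m j j' : V) (ent' : Finset V) (ν c d : Finset V → R)
    (hν0 : ∀ W, 0 ≤ ν W) (hν : ∀ s ⊆ U, ∀ t ⊆ U, ν s * ν t ≤ ν (s ∩ t) * ν (s ∪ t))
    (hc0 : ∀ W, 0 ≤ c W) (hd0 : ∀ W, 0 ≤ d W)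
    (hcd : ∀ s t, c s * d t ≤ c (s ∩ t) * d (s ∪ t))
    (x y : Finset V → R) (hx : ∀ W, x W = if j ∈ W then 1 else 0) (hy : ∀ W, y W = if j' ∈ W then 1 else 0)
    (hxI : ∀ W, (¬ ∃ r ∈ ({m} : Finset V) ∪ ent', r ∈ W) → x W = 0) (hyI : ∀ W, (¬ ∃ r ∈ ({m} : Finset V) ∪ ent', r ∈ W) → y W = 0) :
    0 ≤ ((∑ W ∈ U.powerset.filter (fun W => ¬ ∃ r ∈ ({m} : Finset V) ∪ ent', r ∈ W), ν W * c W) + ((∑ W ∈ U.powerset.filter (fun W => (¬ ∃ r ∈ ({m} : Finset V), r ∈ W) ∧ ∃ r ∈ ent', r ∈ W), ν W * (c W - d W) * ((1 - x W) * (1 - y W))) + (∑ W ∈ U.powerset.filter (fun W => (¬ ∃ r ∈ ({m} : Finset V), r ∈ W) ∧ ∃ r ∈ ent', r ∈ W), ν W * d W * ((1 - x W) * (1 - y W))))) * (∑ W ∈ U.powerset.filter (fun W => ∃ r ∈ ({m} : Finset V), r ∈ W), ν W * d W * (x W * y W)) - ((∑ W ∈ U.powerset.filter (fun W => (¬ ∃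 r ∈ ({m} : Finset V), r ∈ W) ∧ ∃ r ∈ ent', r ∈ W), ν W * (c W - d W) * ((1 - x W) * y W)) + (∑ W ∈ U.powerset.filter (fun W => (¬ ∃ r ∈ ({m} : Finset V), r ∈ W) ∧ ∃ r ∈ ent', r ∈ W), ν W * d W * ((1 - x W) * y W))) * (∑ W ∈ U.powerset.filter (fun W => ∃ r ∈ ({m} : Finset V), r ∈ W), ν W * d W * (x W * (1 - y W))) := by
  have hx0 := mg_x0 j x hx; have hy0 := mg_x0 j' y hy; have hx1 := mg_x1 j x hx; have hy1 := mg_x1 j' y hy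
  have hw : ∀ s t : Finset V, ((1 - x s) * y s) * (x t * (1 - y t)) ≤ ((1 - x (s ∩ t)) * (1 - y (s ∩ t))) * (x (s ∪ t) * y (s ∪ t)) := fun s t => by
    simp only [mg_x_inter j x hx, mg_x_inter j' y hy, mg_x_union j x hx, mg_x_union j' y hy]
    rcases mg_marker_cases j x hx s with hxs | hxs <;> rcases mg_marker_cases j x hx t with hxt | hxt <;>
      rcases mg_marker_cases j' y hy s with hys | hys <;> rcases mg_marker_cases j' y hy t with hyt | hyt <;>
      simp only [hxs, hxt, hys, hyt] <;> norm_num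
  have key : (∑ W ∈ U.powerset.filter (fun W => (¬ ∃ r ∈ ({m} : Finset V), r ∈ W) ∧ ∃ r ∈ ent', r ∈ W), ν W * c W * ((1 - x W) * y W)) * (∑ W ∈ U.powerset.filter (fun W => ∃ r ∈ ({m} : Finset V), r ∈ W), ν W * d W * (x W * (1 - y W))) ≤ (∑ W ∈ U.powerset.filter (fun W => ¬ ∃ r ∈ ({m} : Finset V), r ∈ W), ν W * c W * ((1 - x W) * (1 - y W))) * (∑ W ∈ U.powerset.filter (fun W => ∃ r ∈ ({m} : Finset V), r ∈ W), ν W * d W * (x W * y W)) :=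
    cell_fact U ν (c) (d) (c) (d)
      (fun W => (1 - x W) * y W) (fun W => x W * (1 - y W)) (fun W => (1 - x W) * (1 - y W)) (fun W => x W * y W)
      (fun W => (¬ ∃ r ∈ ({m} : Finset V), r ∈ W) ∧ ∃ r ∈ ent', r ∈ W) (fun W => ∃ r ∈ ({m} : Finset V), r ∈ W) (fun W => ¬ ∃ r ∈ ({m} : Finset V), r ∈ W) (fun W => ∃ r ∈ ({m} : Finset V), r ∈ W)
      hν0 hν hc0 hd0 hc0 hd0 (fun W => mul_nonneg (sub_nonneg.2 (hx1 W)) (hy0 W)) (fun W => mul_nonneg (hx0 W) (sub_nonneg.2 (hy1 W))) (fun W => mul_nonneg (sub_nonneg.2 (hx1 W)) (sub_nonneg.2 (hy1 W))) (fun W => mul_nonneg (hx0 W) (hy0 W))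
      (fun s t hA hB => ⟨fun ⟨r, hr, hrW⟩ => hA.1 ⟨r, hr, (Finset.mem_inter.1 hrW).1⟩, hB.elim (fun r hr => ⟨r, hr.1, Finset.mem_union_right s hr.2⟩)⟩)
      (fun s t _ _ => hcd s t)
      hw
  have eS : (∑ W ∈ U.powerset.filter (fun W => (¬ ∃ r ∈ ({m} : Finset V), r ∈ W) ∧ ∃ r ∈ ent', r ∈ W), ν W * c W * ((1 - x W) * y W)) = (∑ W ∈ U.powerset.filter (fun W => (¬ ∃ r ∈ ({m} : Finset V), r ∈ W) ∧ ∃ r ∈ ent', r ∈ W), ν W * (c W - d W) * ((1 - x W) * y W)) + (∑ W ∈ U.powerset.filter (fun W => (¬ ∃ r ∈ ({m} : Finset V), r ∈ W) ∧ ∃ r ∈ ent', r ∈ W), ν W * d W * ((1 - x W) * y W)) := by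
    rw [← Finset.sum_add_distrib]
    exact Finset.sum_congr rfl (fun W _ => by ring)
  rw [eS] at key
  have eP : (∑ W ∈ U.powerset.filter (fun W => ¬ ∃ r ∈ ({m} : Finset V), r ∈ W), ν W * c W * ((1 - x W) * (1 - y W))) = (∑ W ∈ U.powerset.filter (fun W => ¬ ∃ r ∈ ({m} : Finset V) ∪ ent', r ∈ W), ν W * c W * ((1 - x W) * (1 - y W))) + (∑ W ∈ U.powerset.filter (fun W => (¬ ∃ r ∈ ({m} : Finset V), r ∈ W) ∧ ∃ r ∈ ent', r ∈ W), ν W * c W * ((1 - x W) * (1 - y W))) :=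
    sum_entfree_split U {m} ent' (fun W => ν W * c W * ((1 - x W) * (1 - y W)))
  have eI : (∑ W ∈ U.powerset.filter (fun W => ¬ ∃ r ∈ ({m} : Finset V) ∪ ent', r ∈ W), ν W * c W * ((1 - x W) * (1 - y W))) = (∑ W ∈ U.powerset.filter (fun W => ¬ ∃ r ∈ ({m} : Finset V) ∪ ent', r ∈ W), ν W * c W) :=
    Finset.sum_congr rfl (fun W hW => by
      rw [hxI W (Finset.mem_filter.1 hW).2, hyI W (Finset.mem_filter.1 hW).2]; ring)
  have eD : (∑ W ∈ U.powerset.filter (fun W => (¬ ∃ r ∈ ({m} : Finset V), r ∈ W) ∧ ∃ r ∈ ent', r ∈ W), ν W * c W * ((1 - x W) * (1 - y W))) = (∑ W ∈ U.powerset.filter (fun W => (¬ ∃ r ∈ ({m} : Finset V), r ∈ W) ∧ ∃ r ∈ ent', r ∈ W), ν W * (c W - d W) * ((1 - x W) * (1 - y W))) + (∑ W ∈ U.powerset.filter (fun W => (¬ ∃ r ∈ ({m} : Finset V), r ∈ W) ∧ ∃ r ∈ ent', r ∈ W), ν W * d W * ((1 - x W) * (1 - y W))) := by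
    rw [← Finset.sum_add_distrib]
    exact Finset.sum_congr rfl (fun W _ => by ring)
  rw [eP, eI, eD] at key
  linear_combination key
end CellFactsA

end Summit.Ventures.PercRepro2.Coin
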